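import Mathlib
import HarnessLib
import HarnessLib.Audit
import Summits.ValiantsHypothesis.ValiantsHypothesis.Theorems.LacunarySymmetroidMatrixDescartesToyALawSignChanges

/-!
# ValiantsHypothesis / LacunarySymmetroid — crux `MatrixDescartes` (stmt-ValiantsHypothesis-18050, V1), LINE (A) «product_plus_one»:
# binomial-limit TOY THEOREM, module 2 — sign changes of real exponential polynomials (Pólya–Szegő II, V.75)

For a finite set of exponents `S ⊂ ℝ` and coefficient polynomials `P s ∈ ℝ[X]`, not all zero on `S`, the exponential
polynomial `h(θ) = Σ_{s ∈ S} e^{sθ} P_s(θ)` has at most `Σ_{s∈S} (deg P_s + 1) − 1` sign changes on `ℝ`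
(`SignChangesLE h univ _`, module 1).  This is the sign-change form of Pólya–Szegő II, Part V, Problem 75 (the zero
count with multiplicities), which is what the Laplace variation-diminishing step of pen val-idea-25 g8 NOTE §54.13 consumes.
Proof (classical): strong induction on `|S|`; translate the exponents so that a nonzero term sits at `s = 0`,
differentiate `deg P_0 + 1` times (the operator `Φ_u Q = uQ + Q′` keeps degrees for `u ≠ 0` and kills `P_0`), apply the
Rolle step of module 1 that many times.

HONEST FRAMING: generic real-analysis helper; no stub of LINE (A) is touched; `MatrixDescartes` OPEN; `VP ≠ VNP` is NOT
proved and nothing here bears on it.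
-/

set_option linter.dupNamespace false

namespace Summit.ValiantsHypothesis.ValiantsHypothesis.Theorems.LacunarySymmetroidMatrixDescartes

namespace ToyALaw

open Polynomial Finset Set

/-! ## The operator `Φ_u Q = u·Q + Q′` (`phiOp`, defined in `…ToyALawDefs`) -/

/-- `Φ_0` is the derivative. -/
theorem phiOp_zero_left (Q : ℝ[X]) : phiOp 0 Q = derivative Q := by simp [phiOp]

/-- For `u ≠ 0` and `Q ≠ 0`, `Φ_u Q` has the degree of `Q` and leading coefficient `u · lc(Q)`; in particular it is nonzero. -/
theorem natDegree_phiOp_and_ne_zero {u : ℝ} (hu : u ≠ 0) {Q : ℝ[X]} (hQ : Q ≠ 0) :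
    (phiOp u Q).natDegree = Q.natDegree ∧ phiOp u Q ≠ 0 := by
  have hdeg : (derivative Q).degree < (C u * Q).degree := by
    rw [degree_C_mul hu]
    exact degree_derivative_lt hQ
  have hlc : (phiOp u Q).leadingCoeff = u * Q.leadingCoeff := by
    rw [phiOp, leadingCoeff_add_of_degree_lt' hdeg, leadingCoeff_mul, leadingCoeff_C]
  have hne : phiOp u Q ≠ 0 := by
    intro h
    rw [h, leadingCoeff_zero] at hlc
    exact (mul_ne_zero hu (leadingCoeff_ne_zero.2 hQ)) hlc.symm
  refine ⟨?_, hne⟩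
  rw [phiOp, natDegree_add_eq_left_of_degree_lt hdeg, natDegree_C_mul hu]

/-- Iterates of `Φ_u` (`u ≠ 0`) keep the degree and nonvanishing. -/
theorem natDegree_phiOp_iterate_and_ne_zero {u : ℝ} (hu : u ≠ 0) {Q : ℝ[X]} (hQ : Q ≠ 0) (m : ℕ) :
    ((phiOp u)^[m] Q).natDegree = Q.natDegree ∧ (phiOp u)^[m] Q ≠ 0 := by
  induction m with
  | zero => exact ⟨rfl, hQ⟩
  | succ m ih =>
    rw [Function.iterate_succ_apply']
    obtain ⟨h1, h2⟩ := natDegree_phiOp_and_ne_zero hu ih.2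
    exact ⟨h1.trans ih.1, h2⟩

/-- Iterates of `Φ_u` (`u ≠ 0`) keep the degree (also for `Q = 0`). -/
theorem natDegree_phiOp_iterate {u : ℝ} (hu : u ≠ 0) (Q : ℝ[X]) (m : ℕ) :
    ((phiOp u)^[m] Q).natDegree = Q.natDegree := by
  by_cases hQ : Q = 0
  · subst hQ
    have : ∀ m, (phiOp u)^[m] (0 : ℝ[X]) = 0 := by
      intro m
      induction m with
      | zero => rfl
      | succ m ih => rw [Function.iterate_succ_apply', ih]; simp [phiOp]
    rw [this]
  · exact (natDegree_phiOp_iterate_and_ne_zero hu hQ m).1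

/-- `Φ_0^{m} Q = Q^{(m)} = 0` once `m > deg Q`. -/
theorem phiOp_zero_iterate_eq_zero {Q : ℝ[X]} {m : ℕ} (h : Q.natDegree < m) : (phiOp 0)^[m] Q = 0 := by
  have key : ∀ (m : ℕ) (Q : ℝ[X]), (phiOp 0)^[m] Q = derivative^[m] Q := by
    intro m
    induction m with
    | zero => intro Q; rfl
    | succ m ih =>
      intro Q
      rw [Function.iterate_succ_apply, Function.iterate_succ_apply, phiOp_zero_left, ih]
  rw [key]
  exact iterate_derivative_eq_zero h

/-! ## Exponential polynomials (`expPoly`, defined in `…ToyALawDefs`) -/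

/-- `d/dθ h_{S,P} = h_{S, Φ P}` with `(Φ P)_s = Φ_s P_s`. -/
theorem hasDerivAt_expPoly (S : Finset ℝ) (P : ℝ → ℝ[X]) (θ : ℝ) :
    HasDerivAt (expPoly S P) (expPoly S (fun s => phiOp s (P s)) θ) θ := by
  unfold expPoly
  refine HasDerivAt.fun_sum fun s _ => ?_
  have h1 : HasDerivAt (fun θ => Real.exp (s * θ)) (Real.exp (s * θ) * (s * 1)) θ :=
    ((hasDerivAt_id θ).const_mul s).exp
  have h2 := (P s).hasDerivAt θ
  refine (h1.fun_mul h2).congr_deriv ?_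
  simp only [phiOp, eval_add, eval_mul, eval_C, mul_one]
  ring

/-- The `j`-fold derivative chain of `h_{S,P}`: `g j = h_{S, Φ^j P}`, `g (j+1) = (g j)′`. -/
theorem hasDerivAt_expPoly_iterate (S : Finset ℝ) (P : ℝ → ℝ[X]) (j : ℕ) (θ : ℝ) :
    HasDerivAt (expPoly S (fun s => (phiOp s)^[j] (P s)))
      (expPoly S (fun s => (phiOp s)^[j + 1] (P s)) θ) θ := by
  have := hasDerivAt_expPoly S (fun s => (phiOp s)^[j] (P s)) θ
  simpa only [Function.iterate_succ_apply'] using this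

/-- Translating the exponents: `h_{S,P}(θ) = e^{s₀θ} · h_{S − s₀, P(· + s₀)}(θ)`. -/
theorem expPoly_eq_exp_mul_translate (S : Finset ℝ) (P : ℝ → ℝ[X]) (s₀ θ : ℝ) :
    expPoly S P θ = Real.exp (s₀ * θ) * expPoly (S.image (fun s => s - s₀)) (fun u => P (u + s₀)) θ := by
  unfold expPoly
  rw [sum_image (fun x _ y _ h => by simpa using h), mul_sum]
  refine sum_congr rfl fun s _ => ?_
  show Real.exp (s * θ) * (P s).eval θ = Real.exp (s₀ * θ) * (Real.exp ((s - s₀) * θ) * (P (s - s₀ + s₀)).eval θ)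
  rw [sub_add_cancel, ← mul_assoc, ← Real.exp_add]
  congr 2
  ring

/-- A term with the zero polynomial as coefficient can be erased. -/
theorem expPoly_erase_of_eq_zero {S : Finset ℝ} {P : ℝ → ℝ[X]} {a : ℝ} (h : P a = 0) :
    expPoly (S.erase a) P = expPoly S P := by
  funext θ
  unfold expPoly
  exact sum_erase _ (by simp [h])

/-- If all coefficients but the one at `0 ∈ S` vanish, `h_{S,P} = P_0`. -/
theorem expPoly_eq_eval_of_others_zero {S : Finset ℝ} {P : ℝ → ℝ[X]} (h0 : (0 : ℝ) ∈ S)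
    (h : ∀ u ∈ S.erase 0, P u = 0) (θ : ℝ) : expPoly S P θ = (P 0).eval θ := by
  unfold expPoly
  rw [← add_sum_erase _ _ h0, sum_eq_zero (fun u hu => by simp [h u hu])]
  simp

/-! ## Pólya–Szegő V.75 (sign-change form) -/

/-- **Sign changes of a real exponential polynomial** (Pólya–Szegő II, Part V, Problem 75, in the form `V ≤ …`):
if `P_s ≠ 0` for some `s ∈ S`, then `h_{S,P}(θ) = Σ_{s∈S} e^{sθ} P_s(θ)` has at most `Σ_{s∈S}(deg P_s + 1) − 1` sign
changes on `ℝ`. -/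
theorem signChangesLE_expPoly (S : Finset ℝ) (P : ℝ → ℝ[X]) (h : ∃ s ∈ S, P s ≠ 0) :
    SignChangesLE (expPoly S P) univ (∑ s ∈ S, ((P s).natDegree + 1) - 1) := by
  -- strong induction on the number of exponents
  suffices H : ∀ n (S : Finset ℝ) (P : ℝ → ℝ[X]), S.card = n → (∃ s ∈ S, P s ≠ 0) →
      SignChangesLE (expPoly S P) univ (∑ s ∈ S, ((P s).natDegree + 1) - 1) from H _ S P rfl h
  intro n
  induction n using Nat.strong_induction_on with
  | _ n ih =>
  intro S P hcard hex
  obtain ⟨s₀, hs₀, hP₀⟩ := hex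
  -- translate so that the distinguished exponent is 0
  set T : Finset ℝ := S.image (fun s => s - s₀) with hT
  set Q : ℝ → ℝ[X] := fun u => P (u + s₀) with hQ
  have hinj : Set.InjOn (fun s : ℝ => s - s₀) S := fun x _ y _ h => by simpa using h
  have hTcard : T.card = S.card := card_image_of_injOn hinj
  have hT0 : (0 : ℝ) ∈ T := mem_image.2 ⟨s₀, hs₀, sub_self _⟩
  have hQ0 : Q 0 = P s₀ := by simp [hQ]
  have hsum : ∑ u ∈ T, ((Q u).natDegree + 1) = ∑ s ∈ S, ((P s).natDegree + 1) := by
    rw [hT, sum_image hinj]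
    simp [hQ]
  -- the claim for (T, Q)
  have key : SignChangesLE (expPoly T Q) univ (∑ u ∈ T, ((Q u).natDegree + 1) - 1) := by
    set m : ℕ := (Q 0).natDegree + 1 with hm
    have hsplit : ∑ u ∈ T, ((Q u).natDegree + 1) = m + ∑ u ∈ T.erase 0, ((Q u).natDegree + 1) :=
      (add_sum_erase _ _ hT0).symm
    by_cases hall : ∀ u ∈ T.erase 0, Q u = 0
    · -- only the polynomial term survives
      have hfun : ∀ θ ∈ (univ : Set ℝ), (fun θ => (1 : ℝ) * (Q 0).eval θ) θ = expPoly T Q θ := by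
        intro θ _
        show (1 : ℝ) * (Q 0).eval θ = expPoly T Q θ
        rw [one_mul, expPoly_eq_eval_of_others_zero hT0 hall]
      have hQ0ne : Q 0 ≠ 0 := by rwa [hQ0]
      have hbase := (signChangesLE_mul_polynomial (S := univ) (w := fun _ => (1 : ℝ))
        (fun _ _ => one_pos) hQ0ne).congr hfun
      exact hbase.mono (by rw [hsplit]; omega)
    · push Not at hall
      obtain ⟨u₁, hu₁, hQu₁⟩ := hall
      have hu₁ne : u₁ ≠ 0 := (mem_erase.1 hu₁).1
      set Qm : ℝ → ℝ[X] := fun u => (phiOp u)^[m] (Q u) with hQm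
      have hcard' : (T.erase 0).card < n := by
        rw [card_erase_of_mem hT0, hTcard, hcard]
        have : 0 < S.card := card_pos.2 ⟨s₀, hs₀⟩
        omega
      have hex' : ∃ u ∈ T.erase 0, Qm u ≠ 0 :=
        ⟨u₁, hu₁, (natDegree_phiOp_iterate_and_ne_zero hu₁ne hQu₁ m).2⟩
      have hIH := ih _ hcard' (T.erase 0) Qm rfl hex'
      have hdegs : ∑ u ∈ T.erase 0, ((Qm u).natDegree + 1) = ∑ u ∈ T.erase 0, ((Q u).natDegree + 1) := by
        refine sum_congr rfl fun u hu => ?_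
        rw [hQm, natDegree_phiOp_iterate (mem_erase.1 hu).1]
      rw [hdegs] at hIH
      -- the erased term vanishes: Φ_0^m (Q 0) = 0
      have hQm0 : Qm 0 = 0 := phiOp_zero_iterate_eq_zero (by rw [hm]; omega)
      rw [expPoly_erase_of_eq_zero hQm0] at hIH
      -- m Rolle steps along the derivative chain
      have hchain := SignChangesLE.of_hasDerivAt_iterate (S := univ) (R := ∑ u ∈ T.erase 0, ((Q u).natDegree + 1) - 1)
        (g := fun j => expPoly T (fun u => (phiOp u)^[j] (Q u))) ordConnected_univ
        (fun j θ _ => hasDerivAt_expPoly_iterate T Q j θ) (m := m) hIH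
      have hpos : 1 ≤ ∑ u ∈ T.erase 0, ((Q u).natDegree + 1) :=
        le_trans (by omega) (single_le_sum (f := fun u => (Q u).natDegree + 1) (fun _ _ => Nat.zero_le _) hu₁)
      have harith : ∑ u ∈ T.erase 0, ((Q u).natDegree + 1) - 1 + m = ∑ u ∈ T, ((Q u).natDegree + 1) - 1 := by
        rw [hsplit]; omega
      rw [harith] at hchain
      simpa using hchain
  -- back to (S, P)
  have hexp : ∀ θ ∈ (univ : Set ℝ), (fun θ => Real.exp (s₀ * θ) * expPoly T Q θ) θ = expPoly S P θ :=
    fun θ _ => (expPoly_eq_exp_mul_translate S P s₀ θ).symm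
  rw [← hsum]
  exact (key.mul_pos fun θ _ => Real.exp_pos _).congr hexp

end ToyALaw

end Summit.ValiantsHypothesis.ValiantsHypothesis.Theorems.LacunarySymmetroidMatrixDescartes
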